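import Literature.Probability.FitznerVanDerHofstad2017.NobleBoundsN1IotaReduce
import Literature.Probability.FitznerVanDerHofstad2017.NobleBoundsN1IotaCls00
import Literature.Probability.FitznerVanDerHofstad2017.NobleBoundsN1IotaCls01
import Literature.Probability.FitznerVanDerHofstad2017.NobleBoundsN1IotaCls02
import Literature.Probability.FitznerVanDerHofstad2017.NobleBoundsN1IotaCls10
import Literature.Probability.FitznerVanDerHofstad2017.NobleBoundsN1IotaCls11
import Literature.Probability.FitznerVanDerHofstad2017.NobleBoundsN1IotaCls12
import Literature.Probability.FitznerVanDerHofstad2017.NobleBoundsN1IotaCls20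
import Literature.Probability.FitznerVanDerHofstad2017.NobleBoundsN1IotaCls21
import Literature.Probability.FitznerVanDerHofstad2017.NobleBoundsN1IotaCls22
import HarnessLib

/-!
# Fitzner–van der Hofstad (2017), §6.1 — Lemma 5.3 at `N = 1`: the bound on `Ξ^{(1),ι}` assembled

[FvdH17] = R. Fitzner, R. van der Hofstad, *Mean-field behavior for nearest-neighbor percolation in `d > 10`*,
Electron. J. Probab. **22** (2017), no. 43; extended version arXiv:1506.07977v2: Lemma 5.3, first display
(BoundXiIotaOne-1) "`Σ_x Ξ^{(1),ι}_p(x) ≤ P⃗^ι Ā^ι P⃗^E`" (p. 50) and its proof in §6.1 (p. 59), display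
(lemmapercboundXiiota1-1-step0)
`Ξ^{(1),ι}_p(x) ≤ Σ_{a,b=0}^{2} Σ_{u,κ,w,z,t} (δ_{a,0} δ_{ι,κ} 𝟙{u=w=0} + P^{ι,a}(u,w)) Ā^{κ,a,b}(u,w,t,z) P^{E,b}(t−x,z−x)`:
"the bound follows by repeating the steps leading to (6.5)", with "Case `a = 0` / `a = 1` / `a ≥ 2`" of the
start and the classes `b` of the last sausage as for `Ξ^{(1)}`.

This module is the ASSEMBLY ONLY (node X1-i1-fin): the reduced interface `NobleBoundsN1IotaReduce`
(`nobleXiIotaT_one_le_blocks_of_cls₁₂`, `tsum_ofReal_nobleXiIotaN_one_le_of_cls₁₂`,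
`invTwoD_mul_sum_tsum_nobleXiIotaT_one_le_of_cls₁₂`: the `F^{ι,III}_0` part already discharged) is instantiated at
the joint two-level event `E ι x := NobleJointTwoLevelIota.jointWitIota ι x` of the parts `F^{ι,I}_0 ∪ F^{ι,II}_0`,
whose bond-summed bound `h1` is `NobleJointTwoLevelIota.nobleXiBT_iota_one_le_tsum_pi_jointWitIota` and whose nine
class estimates `h2 (a,b)`, `(a,b) ∈ {0,1,2}²`, are the cells `NobleBoundsN1IotaCls00/01/02/10/11/12/20/21/22`
(`jointWitIota_cls_<a>_<b>`), each
`J(v−u) ℙ_p^{⊗2}(jointWitIota ι x u v w z t ∩ class (a,b)) ≤ Σ_κ 𝟙{v = u+e_κ} P^{ι,a}(u,w) Ā'^{κ,a,b}(u,w,t,z) P^{E,b}(t−x,z−x)`.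
The middle element is the primed `Ā' = blockAbar'` / `(Ā^ι)' = matAbarIota'` of `NobleBlocksPrime` (the
`(a,b) = (0,0)` row corrected as documented there; all other rows are the printed `Ā`).

No named fact, no numeral, no dimension is fixed; nothing here is a cited hypothesis; every `d` and `p`.
-/

noncomputable section

namespace Literature.Probability.FitznerVanDerHofstad2017

open _root_.MeasureTheory Literature.Barriers.CriticalPhenomena Literature.Probability.Percolation
open Literature.Probability.LatticeModels _root_.SimpleGraph
open Literature.Probability.FitznerVanDerHofstad2017.NobleBlocks
open scoped ENNReal Matrix

variable {d : ℕ}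

/-- **The nine class estimates of the `ι`-event, all classes `(a,b) ∈ {0,1,2}²`** — the hypothesis `h2` of
`NobleBoundsN1IotaReduce.nobleXiIotaT_one_le_blocks_of_cls₁₂` / `tsum_ofReal_nobleXiIotaN_one_le_of_cls₁₂` at
`E ι x := jointWitIota ι x`, by the nine cell modules.
[cite: FitznerVanDerHofstad2017, §6.1 proof of Lemma 5.3, "Case a = 0 / a = 1 / a ≥ 2", "b = 1", "b = 2" (arXiv:1506.07977v2 pp. 58–59)] -/
theorem jointWitIota_cls (p : unitInterval) (ι : Fin d × Bool) (x : Site d) :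
    ∀ (a b : Fin 3) (u v w z t : Site d),
      ENNReal.ofReal (bondJ d p (v - u)) * piPerc d p 2 (jointWitIota ι x u v w z t ∩ clsSet u w t z a b) ≤
        ∑ κ : Fin d × Bool, (if v = u + stepVec κ then (1 : ℝ≥0∞) else 0) *
          (blockPiota (Letters.perc d p) ι a u w * blockAbar' (Letters.perc d p) κ a b u w t z *
            blockPE (Letters.perc d p) b (t - x) (z - x)) := by
  intro a b u v w z t
  fin_cases a <;> fin_cases b
  exacts [jointWitIota_cls_zero_zero p ι x u v w z t, jointWitIota_cls_zero_one p ι x u v w z t,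
    jointWitIota_cls_zero_two p ι x u v w z t, jointWitIota_cls_one_zero p ι x u v w z t,
    jointWitIota_cls_one_one p ι x u v w z t, jointWitIota_cls_one_two p ι x u v w z t,
    jointWitIota_cls_two_zero p ι x u v w z t, jointWitIota_cls_two_one p ι x u v w z t,
    jointWitIota_cls_two_two p ι x u v w z t]

/-- **[FvdH17] §6.1, display (lemmapercboundXiiota1-1-step0) — the `x`-space bound on `Ξ^{(1),ι}_p(x)`,
hypothesis-free** (bond percolation on `ℤ^d`, every `p`, every direction `ι`, every `x`):
`Ξ^{(1),ι}_T(x) ≤ Σ_{u,w,t,z} Σ_{κ,a,b} (δ_{a,0} δ_{ι,κ} 𝟙{u=w=0} + P^{ι,a}(u,w)) Ā'^{κ,a,b}(u,w,t,z) P^{E,b}(t−x,z−x)`.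
[cite: FitznerVanDerHofstad2017, §6.1 proof of Lemma 5.3, display (lemmapercboundXiiota1-1-step0) (arXiv:1506.07977v2 p. 59); (3.55) (p. 30)] -/
theorem nobleXiIotaT_one_le_blocks (p : unitInterval) (ι : Fin d × Bool) (x : Site d) :
    nobleXiIotaT d p (stepVec ι) 1 x ≤ ∑' u, ∑' w, ∑' t, ∑' z, ∑ κ : Fin d × Bool, ∑ a : Fin 3, ∑ b : Fin 3,
      (kdeltaPref ι κ a u w + blockPiota (Letters.perc d p) ι a u w) *
        blockAbar' (Letters.perc d p) κ a b u w t z * blockPE (Letters.perc d p) b (t - x) (z - x) :=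
  nobleXiIotaT_one_le_blocks_of_cls₁₂ p ι x (jointWitIota ι x) (nobleXiBT_iota_one_le_tsum_pi_jointWitIota p ι x)
    (jointWitIota_cls p ι x)

/-- **(BoundXiIotaOne-1), `ι`-averaged, in `[0,∞]`, hypothesis-free**:
`(1/2d) Σ_ι Σ_x Ξ^{(1),ι}_T(x) ≤ P⃗^ι (Ā^ι)' P⃗^E` on the percolation letters (every `d`, every `p`).
[cite: FitznerVanDerHofstad2017, Lemma 5.3 (BoundXiIotaOne-1) (arXiv:1506.07977v2 p. 50); §6.1 "the bound follows by repeating the steps leading to (6.5)" (p. 59); §5.1 `(P⃗^ι)_b` (p. 49)] -/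
theorem invTwoD_mul_sum_tsum_nobleXiIotaT_one_le (p : unitInterval) :
    invTwoD d * ∑ ι : Fin d × Bool, ∑' x, nobleXiIotaT d p (stepVec ι) 1 x ≤
      vecPiota (Letters.perc d p) ᵥ* matAbarIota' (Letters.perc d p) ⬝ᵥ vecPE (Letters.perc d p) :=
  invTwoD_mul_sum_tsum_nobleXiIotaT_one_le_of_cls₁₂ p (fun ι x => jointWitIota ι x)
    (fun ι x => nobleXiBT_iota_one_le_tsum_pi_jointWitIota p ι x) (fun ι x => jointWitIota_cls p ι x)

/-- **[FvdH17] Lemma 5.3, first display (BoundXiIotaOne-1) at `N = 1`, on the primed element, hypothesis-free**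
(node X1-i1-fin): for every fixed direction `ι₀`, the real coefficient `Ξ^{(1),ι₀}_p = nobleXiIotaN d p e_{ι₀} 1`
satisfies `Σ_x Ξ^{(1),ι₀}_p(x) ≤ P⃗^ι (Ā^ι)' P⃗^E` on the percolation letters (every `d`, every `p`).
[cite: FitznerVanDerHofstad2017, Lemma 5.3 (BoundXiIotaOne-1) (arXiv:1506.07977v2 p. 50); §6.1 proof of Lemma 5.3 (p. 59); §3.5 (p. 30)] -/
theorem tsum_ofReal_nobleXiIotaN_one_le (p : unitInterval) (ι₀ : Fin d × Bool) :
    ∑' x, ENNReal.ofReal (nobleXiIotaN d p (stepVec ι₀) 1 x) ≤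
      vecPiota (Letters.perc d p) ᵥ* matAbarIota' (Letters.perc d p) ⬝ᵥ vecPE (Letters.perc d p) :=
  tsum_ofReal_nobleXiIotaN_one_le_of_cls₁₂ p (fun ι x => jointWitIota ι x)
    (fun ι x => nobleXiBT_iota_one_le_tsum_pi_jointWitIota p ι x) (fun ι x => jointWitIota_cls p ι x) ι₀

end Literature.Probability.FitznerVanDerHofstad2017

end
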